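import Literature.NumberTheory.Automorphic.HeckeEigencharacterW0Invariance
import Literature.NumberTheory.Automorphic.SymplecticRankOneSatakeClassical
import Literature.NumberTheory.Automorphic.UnitaryRankOneSatakeClassical
import HarnessLib

/-!
# The unramified Hecke eigencharacters in rank one are classified by the torus parameter MODULO `W = {±1}`:
# `λ_{χ'} = λ_χ ⟺ χ' ∈ {χ, χ⁻¹}` for `SL₂ = Sp₂` (any domain `R`), `λ_{β'} = λ_β ⟺ β'₀/β'₂ ∈ {β₀/β₂, β₂/β₀}` for `U(3)`,
# `⟺ β'₀/β'₁ ∈ {β₀/β₁, β₁/β₀}` for `U(2)`, locally and at the places of a number field (Cartier §IV Cor. 4.2; Rogawski §4.5)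

Topic `NumberTheory/Automorphic`; namespaces `Literature.NumberTheory.Automorphic` (§1), `….SymplecticCartan` (§2),
`….HermitianLattice.UnramifiedLocalConjDatum` (§3), `….UnitaryGroup` (§4) (lane `lit-hodgefound`, Track 2 foundations; seat
`lit-hodgefound-p11`, generation 47, row g47-#8).  THEOREMS ONLY: no definition, no named fact, no instance, no notation.
Sequel of `HeckeEigencharacterW0Invariance` (g47-#7: `λ_{χ⁻¹} = λ_χ`, every rank) and of the rank-one Satake ISOMORPHISMS
`SymplecticRankOneSatakeClassical` (g46: `range 𝒮_q = R[x^{±1}]^W` for `SL₂`) and `UnitaryRankOneSatakeClassical` (g46: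
`range 𝒮 = ℂ[Λ⁻]^W` for `U(3)`, `U(2)`): in rank one the `W`-ambiguity `χ ↦ χ⁻¹` is the ONLY ambiguity.

## The mathematics

Cartier Cor. 4.2: the characters of `ℋ(G, K)` are the `ω_χ = λ_χ`, `χ` an unramified character of the torus, and
`ω_χ = ω_{χ'}` iff `χ' ∈ Wχ`.  The tree has `λ_{wχ} = λ_χ` for `w = -1` in every rank (g47-#7); the converse needs the
surjectivity half of the Satake isomorphism, available in rank one.  PROOF (rank one, `W = {±1}`): the symmetric element
`x + x⁻¹` (`x = x^{e}`, `e` the generator of the cocharacter line: `e = 1` for `SL₂`, `e = (1, 0, -1)` for `U(3)`,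
`e = (1, -1)` for `U(2)`) is a Satake transform `𝒮(T₁)` (range theorems), and `λ_χ(T₁) = χ(x) + χ(x)⁻¹`; in a domain
`a + a⁻¹ = b + b⁻¹` forces `b ∈ {a, a⁻¹}` (`(b - a)(ab - 1) = 0`, `Units.eq_or_eq_inv_of_add_inv_eq`); a character of the
cocharacter line is determined by its value on the generator.  For `U(3)` (resp. `U(2)`) the eigencharacter `λ_β`,
`β ∈ (ℂˣ)³` (resp. `(ℂˣ)²`), depends on `β` only through `z = β₀/β₂` (resp. `β₀/β₁`), because every transform is supported on
the antisymmetric cocharacters `(k, 0, -k)` (resp. `(k, -k)`), where `∏ βᵢ^{μᵢ} = z^k`; hence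
**`λ_{β'} = λ_β ⟺ z' = z ∨ z' = z⁻¹`** — the unramified characters of `ℋ(U(3), K₀)` (resp. `ℋ(U(2), K₀)`) are parametrised
by `z + z⁻¹ ∈ ℂ`, i.e. by `ℂˣ/(z ∼ z⁻¹)` (Rogawski §4.5).  For `SL₂ = Sp₂` over any integral domain `R` with `q ∈ Rˣ`:
**`λ_{χ'} = λ_χ ⟺ χ' = χ ∨ χ' = χ⁻¹`**.  The same statements hold for the place-indexed eigencharacters
`symplecticHeckeEigencharacterAdic F v` (`n = 1`, every finite `v`) and `unitaryHeckeEigencharacterAdic c hc1 v w hw hv`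
(`N = 2, 3`, every inert unramified `w`).

## What is formalised (theorems only)

* §1 `Units.eq_or_eq_inv_of_add_inv_eq` (domain: `a + a⁻¹ = b + b⁻¹ ⇒ b = a ∨ b = a⁻¹`), `MonoidHom.eq_of_apply_ofAdd_const_one_eq`
  (characters of `Multiplicative (Fin 1 → ℤ)` are determined on the generator), `laurentEvalAt_single_eq_smul`,
  `laurentMonomialHom_ofAdd_eq_zpow_three/two` (`∏ βᵢ^{μᵢ} = (β₀/β₂)^{μ₀}`, resp. `(β₀/β₁)^{μ₀}`, on `Λ⁻`),
  `prod_zpow_eq_prod_filter_div_zpow`, `laurentMonomialHom_ofAdd_eq_prod_filter` (every `N`: `∏ βᵢ^{μᵢ} = ∏_{i<i'} (βᵢ/β_{i'})^{μᵢ}`).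
* §2 `exists_symplecticSatakeTransform_eq_add_rank_one` (`x + x⁻¹ = 𝒮_q(T₁)`),
  **`symplecticHeckeEigencharacter_eq_iff_rank_one`** (`SL₂`, any domain), `symplecticHeckeEigencharacterAdic_eq_iff_rank_one`.
* §3 **`heckeEigencharacter_eq_of_forall_div_eq_unitary`** (EVERY `N`, any `σ`: `λ_β` depends on `β` only through the ratios
  `βᵢ/β_{i'}`, `i < i'`), `heckeEigencharacter_eq_of_div_eq_unitary_three/two` (`λ_β` depends on `z` only),
  `exists_satakeTransform_eq_add_unitary_three/two`, **`heckeEigencharacter_eq_iff_unitary_three`**,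
  **`heckeEigencharacter_eq_iff_unitary_two`** (`σ ≠ id`).
* §4 `unitaryHeckeEigencharacterAdic_eq_iff_three`, `unitaryHeckeEigencharacterAdic_eq_iff_two` (every inert unramified place).

## References
* [CartierCorvallis1979] P. Cartier, *Representations of 𝔭-adic groups: a survey*, PSPM 33.1 (1979), §IV Thm. 4.1, Cor. 4.2.
* [Rogawski1990] J. Rogawski, *Automorphic Representations of Unitary Groups in Three Variables* (1990), §4.5 p. 50.
* [Satake1963] I. Satake, Publ. Math. IHÉS 18 (1963), §§6–7.
* [Macdonald1995] I. G. Macdonald, *Symmetric Functions and Hall Polynomials*, 2nd ed. (1995), Ch. V (3.4).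
-/

noncomputable section

open scoped Valued WithZero Matrix MatrixGroups
open Matrix MonoidAlgebra Representation NumberField IsDedekindDomain

/-! ## §1 Algebraic preliminaries -/

/-- **In a domain, `a + a⁻¹ = b + b⁻¹` for units forces `b = a` or `b = a⁻¹`** (`(b - a)(ab - 1) = 0`).
[cite: CartierCorvallis1979, §IV Cor. 4.2] -/
theorem Units.eq_or_eq_inv_of_add_inv_eq {R : Type*} [CommRing R] [IsDomain R] (a b : Rˣ)
    (h : (a : R) + ((a⁻¹ : Rˣ) : R) = b + ((b⁻¹ : Rˣ) : R)) : b = a ∨ b = a⁻¹ := by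
  have ha : (a : R) * ((a⁻¹ : Rˣ) : R) = 1 := Units.mul_inv a
  have hb : (b : R) * ((b⁻¹ : Rˣ) : R) = 1 := Units.mul_inv b
  have key : ((b : R) - a) * ((a : R) * b - 1) = 0 := by
    have e : ((b : R) - a) * ((a : R) * b - 1) = ((b + ((b⁻¹ : Rˣ) : R)) - (a + ((a⁻¹ : Rˣ) : R))) * (a * b) := by
      linear_combination (-(a : R)) * hb + (b : R) * ha
    rw [e, h, sub_self, zero_mul]
  rcases mul_eq_zero.1 key with h1 | h1
  · exact Or.inl (Units.val_injective (sub_eq_zero.1 h1))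
  · right
    refine eq_inv_of_mul_eq_one_right (Units.val_injective ?_)
    rw [Units.val_mul, Units.val_one]
    exact sub_eq_zero.1 h1

/-- **A character of the cocharacter line `Multiplicative (Fin 1 → ℤ)` is determined by its value on the generator
`x = (1)`.** [cite: CartierCorvallis1979, §IV Cor. 4.2] -/
theorem MonoidHom.eq_of_apply_ofAdd_const_one_eq {M : Type*} [Monoid M] {χ χ' : Multiplicative (Fin 1 → ℤ) →* M}
    (h : χ' (Multiplicative.ofAdd fun _ => (1 : ℤ)) = χ (Multiplicative.ofAdd fun _ => (1 : ℤ))) : χ' = χ := by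
  let ι : Multiplicative ℤ →* Multiplicative (Fin 1 → ℤ) :=
    AddMonoidHom.toMultiplicative (AddMonoidHom.mk' (fun k : ℤ => fun _ : Fin 1 => k) fun _ _ => rfl)
  have hsurj : ∀ m : Multiplicative (Fin 1 → ℤ), ∃ k : Multiplicative ℤ, ι k = m := fun m =>
    ⟨Multiplicative.ofAdd (Multiplicative.toAdd m 0), by
      change Multiplicative.ofAdd (fun _ : Fin 1 => Multiplicative.toAdd m 0) = m
      conv_rhs => rw [← ofAdd_toAdd m]
      exact congrArg Multiplicative.ofAdd (funext fun i => congrArg (Multiplicative.toAdd m) (Subsingleton.elim 0 i))⟩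
  have hcomp : χ'.comp ι = χ.comp ι := MonoidHom.ext_mint h
  refine MonoidHom.ext fun m => ?_
  obtain ⟨k, rfl⟩ := hsurj m
  exact DFunLike.congr_fun hcomp k

namespace Literature.NumberTheory.Automorphic

/-- `ev_z(c x^m) = c · ∏ zᵢ^{mᵢ}` with the product read in `ℂˣ`. [cite: CartierCorvallis1979, §IV (4.2)] -/
theorem laurentEvalAt_single_eq_smul {n : ℕ} (z : Fin n → ℂˣ) (m : Fin n → ℤ) (c : ℂ) :
    laurentEvalAt z (AddMonoidAlgebra.single m c) = c • laurentMonomialHom z (Multiplicative.ofAdd m) := by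
  rw [laurentEvalAt, AddMonoidAlgebra.lift_single]

/-- **On the antisymmetric cocharacters of `U(3)`, `∏ βᵢ^{μᵢ} = (β₀/β₂)^{μ₀}`** (`μ = (k, 0, -k)`).
[cite: Rogawski1990, §4.5 p. 50] -/
theorem laurentMonomialHom_ofAdd_eq_zpow_three (β : Fin 3 → ℂˣ) {μ : Fin 3 → ℤ} (hμ : ∀ i, μ (Fin.rev i) = -μ i) :
    laurentMonomialHom β (Multiplicative.ofAdd μ) = (((β 0 / β 2) ^ μ 0 : ℂˣ) : ℂ) := by
  have h2 : μ 2 = -μ 0 := by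
    have := hμ 0
    rwa [show Fin.rev (0 : Fin 3) = 2 from by decide] at this
  have h1 : μ 1 = 0 := by
    have := hμ 1
    rw [show Fin.rev (1 : Fin 3) = 1 from by decide] at this
    omega
  change (((∏ i, β i ^ (Multiplicative.toAdd (Multiplicative.ofAdd μ) i) : ℂˣ) : ℂ)) = _
  rw [toAdd_ofAdd, Fin.prod_univ_three, h1, h2, zpow_zero, mul_one, _root_.zpow_neg, div_zpow, div_eq_mul_inv]

/-- **On the antisymmetric cocharacters of `U(2)`, `∏ βᵢ^{μᵢ} = (β₀/β₁)^{μ₀}`** (`μ = (k, -k)`). [cite: Rogawski1990, §4.5 p. 50] -/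
theorem laurentMonomialHom_ofAdd_eq_zpow_two (β : Fin 2 → ℂˣ) {μ : Fin 2 → ℤ} (hμ : ∀ i, μ (Fin.rev i) = -μ i) :
    laurentMonomialHom β (Multiplicative.ofAdd μ) = (((β 0 / β 1) ^ μ 0 : ℂˣ) : ℂ) := by
  have h1 : μ 1 = -μ 0 := by
    have := hμ 0
    rwa [show Fin.rev (0 : Fin 2) = 1 from by decide] at this
  change (((∏ i, β i ^ (Multiplicative.toAdd (Multiplicative.ofAdd μ) i) : ℂˣ) : ℂ)) = _
  rw [toAdd_ofAdd, Fin.prod_univ_two, h1, _root_.zpow_neg, div_zpow, div_eq_mul_inv]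

/-- **Pairing `i ↔ i'` in a product over an antisymmetric exponent**: `∏ᵢ βᵢ^{μᵢ} = ∏_{i<i'} (βᵢ/β_{i'})^{μᵢ}` (`μ_{i'} = -μᵢ`;
the self-dual index, if any, carries `μ = 0`). [cite: Rogawski1990, §4.5 p. 50] [cite: Minguez2011, §4] -/
theorem prod_zpow_eq_prod_filter_div_zpow {N : ℕ} {G : Type*} [CommGroup G] (β : Fin N → G) {μ : Fin N → ℤ}
    (hμ : ∀ i, μ (Fin.rev i) = -μ i) :
    ∏ i, β i ^ μ i = ∏ i ∈ (Finset.univ : Finset (Fin N)) with i < Fin.rev i, (β i / β (Fin.rev i)) ^ μ i := by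
  rw [← Finset.prod_filter_mul_prod_filter_not Finset.univ (fun i => i < Fin.rev i),
    ← Finset.prod_filter_mul_prod_filter_not (Finset.univ.filter fun i => ¬ i < Fin.rev i) (fun i => Fin.rev i < i)]
  have h0 : ∏ i ∈ ((Finset.univ : Finset (Fin N)).filter fun i => ¬ i < Fin.rev i).filter (fun i => ¬ Fin.rev i < i),
      β i ^ μ i = 1 :=
    Finset.prod_eq_one fun i hi => by
      simp only [Finset.mem_filter, Finset.mem_univ, true_and, not_lt] at hi
      have heq : Fin.rev i = i := le_antisymm hi.1 hi.2
      have h := hμ i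
      rw [heq] at h
      have h0 : μ i = 0 := by omega
      rw [h0, zpow_zero]
  have h1 : ∏ i ∈ ((Finset.univ : Finset (Fin N)).filter fun i => ¬ i < Fin.rev i).filter (fun i => Fin.rev i < i),
      β i ^ μ i = ∏ i ∈ (Finset.univ : Finset (Fin N)) with i < Fin.rev i, β (Fin.rev i) ^ (-μ i) := by
    refine Finset.prod_equiv Fin.revPerm (fun i => ?_) (fun i _ => ?_)
    · simp only [Finset.mem_filter, Finset.mem_univ, true_and, Fin.revPerm_apply, Fin.rev_rev, not_lt]
      exact ⟨fun h => h.2, fun h => ⟨h.le, h⟩⟩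
    · rw [Fin.revPerm_apply, Fin.rev_rev, hμ, neg_neg]
  rw [h0, mul_one, h1, ← Finset.prod_mul_distrib]
  exact Finset.prod_congr rfl fun i _ => by rw [div_zpow, _root_.zpow_neg, div_eq_mul_inv]

/-- **On the antisymmetric cocharacters of `U_N`, `∏ᵢ βᵢ^{μᵢ} = ∏_{i<i'} (βᵢ/β_{i'})^{μᵢ}`**: the monomial character of
`β ∈ (ℂˣ)^N` restricted to `Λ⁻` only sees the ratios `βᵢ/β_{i'}`, `i < i'`. [cite: Rogawski1990, §4.5 p. 50] [cite: Minguez2011, §4] -/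
theorem laurentMonomialHom_ofAdd_eq_prod_filter {N : ℕ} (β : Fin N → ℂˣ) {μ : Fin N → ℤ} (hμ : ∀ i, μ (Fin.rev i) = -μ i) :
    laurentMonomialHom β (Multiplicative.ofAdd μ) =
      (((∏ i ∈ (Finset.univ : Finset (Fin N)) with i < Fin.rev i, (β i / β (Fin.rev i)) ^ μ i : ℂˣ)) : ℂ) := by
  change (((∏ i, β i ^ (Multiplicative.toAdd (Multiplicative.ofAdd μ) i) : ℂˣ) : ℂ)) = _
  rw [toAdd_ofAdd, prod_zpow_eq_prod_filter_div_zpow β hμ]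

end Literature.NumberTheory.Automorphic

/-! ## §2 `SL₂ = Sp₂`: `λ_{χ'} = λ_χ ⟺ χ' ∈ {χ, χ⁻¹}` -/

namespace Literature.NumberTheory.Automorphic.SymplecticCartan

open Literature.NumberTheory.Automorphic.CartanUnique Literature.NumberTheory.Automorphic

section Local

variable {K : Type*} [Field K] [Valued K ℤᵐ⁰] {ϖ : K} {R : Type*} [CommRing R]
  (hϖ : Valued.v ϖ = WithZero.exp (-1 : ℤ)) [Finite 𝓀[K]]
  [IsHeckeTriple (⊤ : Submonoid (symplecticGroup (Fin 1) K)) (symplecticInt (Fin 1) K) (symplecticInt (Fin 1) K)]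
include hϖ

/-- **`x + x⁻¹` is a Satake transform**: there is `T₁ ∈ ℋ(SL₂(K), SL₂(𝒪); R)` with `𝒮_q(T₁) = x + x⁻¹` (`q ∈ Rˣ` the residue
cardinality; the rank-one Satake isomorphism onto the symmetric Laurent polynomials).
[cite: CartierCorvallis1979, §IV Thm. 4.1] [cite: Macdonald1995, Ch. V (3.4)] -/
theorem exists_symplecticSatakeTransform_eq_add_rank_one (q : Rˣ) (hq : (q : R) = Nat.card 𝓀[K]) :
    ∃ T : heckeAlgebra R (symplecticGroup (Fin 1) K) (symplecticInt (Fin 1) K),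
      symplecticSatakeTransform hϖ q T =
        AddMonoidAlgebra.single (fun _ : Fin 1 => (1 : ℤ)) 1 + AddMonoidAlgebra.single (-fun _ : Fin 1 => (1 : ℤ)) 1 := by
  have hmem : AddMonoidAlgebra.single (fun _ : Fin 1 => (1 : ℤ)) (1 : R) + AddMonoidAlgebra.single (-fun _ : Fin 1 => (1 : ℤ)) 1 ∈
      Set.range (symplecticSatakeTransform (n := 1) (R := R) hϖ q) := by
    rw [range_symplecticSatakeTransform_rank_one hϖ q hq]
    intro μ
    rw [AddMonoidAlgebra.coeff_add, Finsupp.add_apply, Finsupp.add_apply, AddMonoidAlgebra.coeff_single,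
      AddMonoidAlgebra.coeff_single, Finsupp.single_apply, Finsupp.single_apply, Finsupp.single_apply, Finsupp.single_apply,
      add_comm]
    congr 1
    · simp only [neg_inj]
    · simp only [neg_eq_iff_eq_neg]
  exact hmem

/-- **`λ_{χ'} = λ_χ ⟺ χ' = χ ∨ χ' = χ⁻¹` FOR `SL₂(K)`** over any integral domain `R` in which the residue cardinality `q` is a
unit: the unramified characters of `ℋ(SL₂(K), SL₂(𝒪); R)` are the `λ_χ` up to EXACTLY the Weyl ambiguity `χ ↦ χ⁻¹`
(`⟸` g47-#7; `⟹` by testing on `T₁` with `𝒮_q(T₁) = x + x⁻¹`: `χ'(x) + χ'(x)⁻¹ = χ(x) + χ(x)⁻¹`).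
[cite: CartierCorvallis1979, §IV Thm. 4.1, Cor. 4.2] [cite: Macdonald1995, Ch. V (3.4)] [cite: Satake1963, §§6–7] -/
theorem symplecticHeckeEigencharacter_eq_iff_rank_one [IsDomain R] (q : Rˣ) (hq : (q : R) = Nat.card 𝓀[K])
    (χ χ' : Multiplicative (Fin 1 → ℤ) →* R) :
    symplecticHeckeEigencharacter hϖ q χ' = symplecticHeckeEigencharacter hϖ q χ ↔ (χ' = χ ∨ χ' = χ.comp invMonoidHom) := by
  constructor
  · intro h
    obtain ⟨T, hT⟩ := exists_symplecticSatakeTransform_eq_add_rank_one hϖ q hq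
    have hχ : ∀ ψ : Multiplicative (Fin 1 → ℤ) →* R, ψ (Multiplicative.ofAdd fun _ : Fin 1 => (1 : ℤ))⁻¹ =
        (((ψ.toHomUnits (Multiplicative.ofAdd fun _ : Fin 1 => (1 : ℤ)))⁻¹ : Rˣ) : R) := fun ψ => by
      rw [← MonoidHom.coe_toHomUnits ψ, map_inv]
    have key := DFunLike.congr_fun h T
    rw [symplecticHeckeEigencharacter, symplecticHeckeEigencharacter, IsIwasawaExponent.heckeEigencharacter_apply,
      IsIwasawaExponent.heckeEigencharacter_apply, ← symplecticSatakeTransform_eq, hT, map_add, map_add,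
      AddMonoidAlgebra.lift_single, AddMonoidAlgebra.lift_single, AddMonoidAlgebra.lift_single, AddMonoidAlgebra.lift_single,
      one_smul, one_smul, one_smul, one_smul, ofAdd_neg, hχ χ, hχ χ', ← MonoidHom.coe_toHomUnits χ,
      ← MonoidHom.coe_toHomUnits χ'] at key
    rcases Units.eq_or_eq_inv_of_add_inv_eq _ _ key.symm with h1 | h1
    · left
      refine MonoidHom.eq_of_apply_ofAdd_const_one_eq ?_
      rw [← MonoidHom.coe_toHomUnits χ, ← MonoidHom.coe_toHomUnits χ', h1]
    · right
      refine MonoidHom.eq_of_apply_ofAdd_const_one_eq ?_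
      rw [MonoidHom.comp_apply, invMonoidHom_apply, hχ χ, ← MonoidHom.coe_toHomUnits χ', h1]
  · rintro (rfl | rfl)
    · rfl
    · exact symplecticHeckeEigencharacter_comp_inv hϖ q hq χ

end Local

section NumberField

variable (F : Type*) [Field F] [NumberField F] (v : HeightOneSpectrum (𝓞 F))

/-- **`λ_{χ'} = λ_χ ⟺ χ' = χ ∨ χ' = χ⁻¹` for `SL₂(F_v)` at every finite place `v`.** [cite: CartierCorvallis1979, §IV Cor. 4.2]
[cite: Macdonald1995, Ch. V (3.4)] -/
theorem symplecticHeckeEigencharacterAdic_eq_iff_rank_one (χ χ' : Multiplicative (Fin 1 → ℤ) →* ℂ) :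
    symplecticHeckeEigencharacterAdic F v χ' = symplecticHeckeEigencharacterAdic F v χ ↔
      (χ' = χ ∨ χ' = χ.comp invMonoidHom) := by
  haveI := finite_residueField_adicCompletion F v
  haveI := isHeckeTriple_symplecticInt_adicCompletion F v (l := Fin 1)
  exact symplecticHeckeEigencharacter_eq_iff_rank_one (v_adicUniformizer F v) (residueNormUnit F v)
    (coe_residueNormUnit_eq_natCard F v) χ χ'

end NumberField

end Literature.NumberTheory.Automorphic.SymplecticCartan

/-! ## §3 `U(3)` and `U(2)`: `λ_{β'} = λ_β ⟺ z' ∈ {z, z⁻¹}` -/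

namespace Literature.NumberTheory.Automorphic.HermitianLattice

open Literature.NumberTheory.Automorphic.CartanUnique Literature.NumberTheory.Automorphic.SymplecticCartan
  Literature.NumberTheory.Automorphic

variable {K : Type*} [Field K] [Valued K ℤᵐ⁰] {σ : K →+* K} {ϖ : K} [Finite 𝓀[K]]

namespace UnramifiedLocalConjDatum

/-- **`λ_β` OF `U_N` DEPENDS ON `β ∈ (ℂˣ)^N` ONLY THROUGH THE RATIOS `βᵢ/β_{i'}`, `i < i'`** (every `N`, any `σ`): the
unramified eigencharacters factor through the quotient `β ↦ (βᵢ/β_{i'})_{i<i'}` of the dual torus, because every Satake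
transform is supported on the antisymmetric cocharacters (`coeff_satakeTransform_eq_zero_of_not_rev`).
[cite: Minguez2011, §4] [cite: Rogawski1990, §4.5 p. 50] [cite: CartierCorvallis1979, §IV (4.2)–(4.4)] -/
theorem heckeEigencharacter_eq_of_forall_div_eq_unitary {N : ℕ} (hd : UnramifiedLocalConjDatum σ ϖ) (β β' : Fin N → ℂˣ)
    (h : ∀ i : Fin N, i < Fin.rev i → β' i / β' (Fin.rev i) = β i / β (Fin.rev i)) :
    hd.heckeEigencharacter β' = hd.heckeEigencharacter β := by
  refine AlgHom.ext fun T => ?_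
  have hvan : ∀ μ : Fin N → ℤ, (¬ ∀ i, μ (Fin.rev i) = -μ i) → (hd.satakeTransform T).coeff μ = 0 := fun μ hμ => by
    rw [hd.satakeTransform_eq_isIwasawaExponent_satakeTransform]
    exact hd.coeff_satakeTransform_eq_zero_of_not_rev _ T hμ
  rw [hd.heckeEigencharacter_apply, hd.heckeEigencharacter_apply, laurentEvalAt, laurentEvalAt, AddMonoidAlgebra.lift_apply,
    AddMonoidAlgebra.lift_apply]
  refine Finsupp.sum_congr fun μ hμ => ?_
  have hanti : ∀ i, μ (Fin.rev i) = -μ i := by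
    by_contra hn
    exact (Finsupp.mem_support_iff.1 hμ) (hvan μ hn)
  simp only [laurentMonomialHom_ofAdd_eq_prod_filter _ hanti,
    Finset.prod_congr rfl fun i (hi : i ∈ (Finset.univ : Finset (Fin N)).filter fun i => i < Fin.rev i) =>
      congrArg (fun x : ℂˣ => x ^ μ i) (h i (Finset.mem_filter.1 hi).2)]

section Three

variable [IsHeckeTriple (⊤ : Submonoid (unitaryGroupOfForm σ ((StdForm.antidiagonal 3).over K)))
  (unitaryInt σ ((StdForm.antidiagonal 3).over K)) (unitaryInt σ ((StdForm.antidiagonal 3).over K))]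

omit [IsHeckeTriple (⊤ : Submonoid (unitaryGroupOfForm σ ((StdForm.antidiagonal 3).over K)))
  (unitaryInt σ ((StdForm.antidiagonal 3).over K)) (unitaryInt σ ((StdForm.antidiagonal 3).over K))] in
/-- **`λ_β` of `U(3)` depends on `β ∈ (ℂˣ)³` only through `z = β₀/β₂`** (every transform is supported on `Λ⁻ = {(k, 0, -k)}`,
where `∏ βᵢ^{μᵢ} = z^k`; any `σ`). [cite: Rogawski1990, §4.5 p. 50] [cite: CartierCorvallis1979, §IV (4.2)] -/
theorem heckeEigencharacter_eq_of_div_eq_unitary_three (hd : UnramifiedLocalConjDatum σ ϖ) (β β' : Fin 3 → ℂˣ)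
    (h : β' 0 / β' 2 = β 0 / β 2) : hd.heckeEigencharacter β' = hd.heckeEigencharacter β := by
  refine AlgHom.ext fun T => ?_
  have hvan : ∀ μ : Fin 3 → ℤ, (¬ ∀ i, μ (Fin.rev i) = -μ i) → (hd.satakeTransform T).coeff μ = 0 := fun μ hμ => by
    rw [hd.satakeTransform_eq_isIwasawaExponent_satakeTransform]
    exact hd.coeff_satakeTransform_eq_zero_of_not_rev _ T hμ
  rw [hd.heckeEigencharacter_apply, hd.heckeEigencharacter_apply, laurentEvalAt, laurentEvalAt, AddMonoidAlgebra.lift_apply,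
    AddMonoidAlgebra.lift_apply]
  refine Finsupp.sum_congr fun μ hμ => ?_
  have hanti : ∀ i, μ (Fin.rev i) = -μ i := by
    by_contra hn
    exact (Finsupp.mem_support_iff.1 hμ) (hvan μ hn)
  simp only [laurentMonomialHom_ofAdd_eq_zpow_three _ hanti, h]

/-- **`x + x⁻¹` is a Satake transform for `U(3)`** (`x = x^{(1,0,-1)}`; `σ ≠ id`; the rank-one Satake isomorphism).
[cite: CartierCorvallis1979, §IV Thm. 4.1] [cite: Rogawski1990, §4.5 p. 50] -/
theorem exists_satakeTransform_eq_add_unitary_three (hd : UnramifiedLocalConjDatum σ ϖ) (hσ : ∃ x : K, σ x ≠ x) :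
    ∃ T : heckeAlgebra ℂ (unitaryGroupOfForm σ ((StdForm.antidiagonal 3).over K)) (unitaryInt σ ((StdForm.antidiagonal 3).over K)),
      hd.satakeTransform T = AddMonoidAlgebra.single (![1, 0, -1] : Fin 3 → ℤ) 1 + AddMonoidAlgebra.single (-![1, 0, -1]) 1 := by
  have he : ∀ i : Fin 3, (![1, 0, -1] : Fin 3 → ℤ) (Fin.rev i) = -(![1, 0, -1] : Fin 3 → ℤ) i := by decide
  have he' : ∀ i : Fin 3, (-![1, 0, -1] : Fin 3 → ℤ) (Fin.rev i) = -(-![1, 0, -1] : Fin 3 → ℤ) i := fun i => by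
    rw [Pi.neg_apply, Pi.neg_apply, he]
  have hmem : AddMonoidAlgebra.single (![1, 0, -1] : Fin 3 → ℤ) (1 : ℂ) + AddMonoidAlgebra.single (-![1, 0, -1]) 1 ∈
      Set.range (hd.satakeTransform (N := 3)) := by
    rw [hd.range_satakeTransform_unitary_three hσ]
    refine ⟨fun μ hμ => ?_, fun μ => ?_⟩
    · rw [AddMonoidAlgebra.coeff_add, Finsupp.add_apply, AddMonoidAlgebra.coeff_single, AddMonoidAlgebra.coeff_single,
        Finsupp.single_apply, Finsupp.single_apply, if_neg, if_neg, add_zero]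
      · rintro rfl; exact hμ he'
      · rintro rfl; exact hμ he
    · rw [AddMonoidAlgebra.coeff_add, Finsupp.add_apply, Finsupp.add_apply, AddMonoidAlgebra.coeff_single,
        AddMonoidAlgebra.coeff_single, Finsupp.single_apply, Finsupp.single_apply, Finsupp.single_apply, Finsupp.single_apply,
        add_comm]
      congr 1
      · simp only [neg_inj]
      · simp only [neg_eq_iff_eq_neg]
  exact hmem

/-- **`λ_{β'} = λ_β ⟺ β'₀/β'₂ = β₀/β₂ ∨ β'₀/β'₂ = β₂/β₀` FOR `U(3)`** (`σ ≠ id`): the unramified characters of `ℋ(U(3), K₀)` are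
parametrised by `z + z⁻¹`, `z = β₀/β₂ ∈ ℂˣ` — the torus parameter modulo EXACTLY the Weyl group `W = {±1}`
(`⟸`: dependence on `z` only and g47-#7; `⟹`: test on `T₁`, `𝒮(T₁) = x + x⁻¹`, `λ_β(T₁) = z + z⁻¹`).
[cite: CartierCorvallis1979, §IV Thm. 4.1, Cor. 4.2] [cite: Rogawski1990, §4.5 p. 50] [cite: Satake1963, §§6–7] -/
theorem heckeEigencharacter_eq_iff_unitary_three (hd : UnramifiedLocalConjDatum σ ϖ) (hσ : ∃ x : K, σ x ≠ x)
    (β β' : Fin 3 → ℂˣ) :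
    hd.heckeEigencharacter β' = hd.heckeEigencharacter β ↔ (β' 0 / β' 2 = β 0 / β 2 ∨ β' 0 / β' 2 = (β 0 / β 2)⁻¹) := by
  constructor
  · intro h
    obtain ⟨T, hT⟩ := hd.exists_satakeTransform_eq_add_unitary_three hσ
    have he : ∀ i : Fin 3, (![1, 0, -1] : Fin 3 → ℤ) (Fin.rev i) = -(![1, 0, -1] : Fin 3 → ℤ) i := by decide
    have he' : ∀ i : Fin 3, (-![1, 0, -1] : Fin 3 → ℤ) (Fin.rev i) = -(-![1, 0, -1] : Fin 3 → ℤ) i := fun i => by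
      rw [Pi.neg_apply, Pi.neg_apply, he]
    have key := DFunLike.congr_fun h T
    rw [hd.heckeEigencharacter_apply, hd.heckeEigencharacter_apply, hT, map_add, map_add, laurentEvalAt_single_eq_smul,
      laurentEvalAt_single_eq_smul, laurentEvalAt_single_eq_smul, laurentEvalAt_single_eq_smul, one_smul, one_smul, one_smul,
      one_smul, laurentMonomialHom_ofAdd_eq_zpow_three _ he, laurentMonomialHom_ofAdd_eq_zpow_three _ he',
      laurentMonomialHom_ofAdd_eq_zpow_three _ he, laurentMonomialHom_ofAdd_eq_zpow_three _ he'] at key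
    simp only [Matrix.cons_val_zero, Pi.neg_apply, zpow_one, _root_.zpow_neg_one] at key
    exact Units.eq_or_eq_inv_of_add_inv_eq _ _ key.symm
  · rintro (h | h)
    · exact hd.heckeEigencharacter_eq_of_div_eq_unitary_three β β' h
    · rw [← hd.heckeEigencharacter_inv_unitary hσ β']
      refine hd.heckeEigencharacter_eq_of_div_eq_unitary_three β β'⁻¹ ?_
      rw [Pi.inv_apply, Pi.inv_apply, inv_div_inv, ← inv_div, h, inv_inv]

end Three

section Two

variable [IsHeckeTriple (⊤ : Submonoid (unitaryGroupOfForm σ ((StdForm.antidiagonal 2).over K)))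
  (unitaryInt σ ((StdForm.antidiagonal 2).over K)) (unitaryInt σ ((StdForm.antidiagonal 2).over K))]

omit [IsHeckeTriple (⊤ : Submonoid (unitaryGroupOfForm σ ((StdForm.antidiagonal 2).over K)))
  (unitaryInt σ ((StdForm.antidiagonal 2).over K)) (unitaryInt σ ((StdForm.antidiagonal 2).over K))] in
/-- **`λ_β` of `U(2)` depends on `β ∈ (ℂˣ)²` only through `z = β₀/β₁`** (support on `Λ⁻ = {(k, -k)}`; any `σ`).
[cite: Rogawski1990, §4.5 p. 50] [cite: CartierCorvallis1979, §IV (4.2)] -/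
theorem heckeEigencharacter_eq_of_div_eq_unitary_two (hd : UnramifiedLocalConjDatum σ ϖ) (β β' : Fin 2 → ℂˣ)
    (h : β' 0 / β' 1 = β 0 / β 1) : hd.heckeEigencharacter β' = hd.heckeEigencharacter β := by
  refine AlgHom.ext fun T => ?_
  have hvan : ∀ μ : Fin 2 → ℤ, (¬ ∀ i, μ (Fin.rev i) = -μ i) → (hd.satakeTransform T).coeff μ = 0 := fun μ hμ => by
    rw [hd.satakeTransform_eq_isIwasawaExponent_satakeTransform]
    exact hd.coeff_satakeTransform_eq_zero_of_not_rev _ T hμ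
  rw [hd.heckeEigencharacter_apply, hd.heckeEigencharacter_apply, laurentEvalAt, laurentEvalAt, AddMonoidAlgebra.lift_apply,
    AddMonoidAlgebra.lift_apply]
  refine Finsupp.sum_congr fun μ hμ => ?_
  have hanti : ∀ i, μ (Fin.rev i) = -μ i := by
    by_contra hn
    exact (Finsupp.mem_support_iff.1 hμ) (hvan μ hn)
  simp only [laurentMonomialHom_ofAdd_eq_zpow_two _ hanti, h]

/-- **`x + x⁻¹` is a Satake transform for `U(2)`** (`x = x^{(1,-1)}`; `σ ≠ id`). [cite: CartierCorvallis1979, §IV Thm. 4.1]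
[cite: Rogawski1990, §4.5 p. 50] -/
theorem exists_satakeTransform_eq_add_unitary_two (hd : UnramifiedLocalConjDatum σ ϖ) (hσ : ∃ x : K, σ x ≠ x) :
    ∃ T : heckeAlgebra ℂ (unitaryGroupOfForm σ ((StdForm.antidiagonal 2).over K)) (unitaryInt σ ((StdForm.antidiagonal 2).over K)),
      hd.satakeTransform T = AddMonoidAlgebra.single (![1, -1] : Fin 2 → ℤ) 1 + AddMonoidAlgebra.single (-![1, -1]) 1 := by
  have he : ∀ i : Fin 2, (![1, -1] : Fin 2 → ℤ) (Fin.rev i) = -(![1, -1] : Fin 2 → ℤ) i := by decide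
  have he' : ∀ i : Fin 2, (-![1, -1] : Fin 2 → ℤ) (Fin.rev i) = -(-![1, -1] : Fin 2 → ℤ) i := fun i => by
    rw [Pi.neg_apply, Pi.neg_apply, he]
  have hmem : AddMonoidAlgebra.single (![1, -1] : Fin 2 → ℤ) (1 : ℂ) + AddMonoidAlgebra.single (-![1, -1]) 1 ∈
      Set.range (hd.satakeTransform (N := 2)) := by
    rw [hd.range_satakeTransform_unitary_two hσ]
    refine ⟨fun μ hμ => ?_, fun μ => ?_⟩
    · rw [AddMonoidAlgebra.coeff_add, Finsupp.add_apply, AddMonoidAlgebra.coeff_single, AddMonoidAlgebra.coeff_single,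
        Finsupp.single_apply, Finsupp.single_apply, if_neg, if_neg, add_zero]
      · rintro rfl; exact hμ he'
      · rintro rfl; exact hμ he
    · rw [AddMonoidAlgebra.coeff_add, Finsupp.add_apply, Finsupp.add_apply, AddMonoidAlgebra.coeff_single,
        AddMonoidAlgebra.coeff_single, Finsupp.single_apply, Finsupp.single_apply, Finsupp.single_apply, Finsupp.single_apply,
        add_comm]
      congr 1
      · simp only [neg_inj]
      · simp only [neg_eq_iff_eq_neg]
  exact hmem

/-- **`λ_{β'} = λ_β ⟺ β'₀/β'₁ = β₀/β₁ ∨ β'₀/β'₁ = β₁/β₀` FOR `U(2)`** (`σ ≠ id`): the torus parameter of an unramified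
eigencharacter of `ℋ(U(2), K₀)` is `z = β₀/β₁` modulo exactly `z ↦ z⁻¹`. [cite: CartierCorvallis1979, §IV Thm. 4.1, Cor. 4.2]
[cite: Rogawski1990, §4.5 p. 50] [cite: Satake1963, §§6–7] -/
theorem heckeEigencharacter_eq_iff_unitary_two (hd : UnramifiedLocalConjDatum σ ϖ) (hσ : ∃ x : K, σ x ≠ x)
    (β β' : Fin 2 → ℂˣ) :
    hd.heckeEigencharacter β' = hd.heckeEigencharacter β ↔ (β' 0 / β' 1 = β 0 / β 1 ∨ β' 0 / β' 1 = (β 0 / β 1)⁻¹) := by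
  constructor
  · intro h
    obtain ⟨T, hT⟩ := hd.exists_satakeTransform_eq_add_unitary_two hσ
    have he : ∀ i : Fin 2, (![1, -1] : Fin 2 → ℤ) (Fin.rev i) = -(![1, -1] : Fin 2 → ℤ) i := by decide
    have he' : ∀ i : Fin 2, (-![1, -1] : Fin 2 → ℤ) (Fin.rev i) = -(-![1, -1] : Fin 2 → ℤ) i := fun i => by
      rw [Pi.neg_apply, Pi.neg_apply, he]
    have key := DFunLike.congr_fun h T
    rw [hd.heckeEigencharacter_apply, hd.heckeEigencharacter_apply, hT, map_add, map_add, laurentEvalAt_single_eq_smul,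
      laurentEvalAt_single_eq_smul, laurentEvalAt_single_eq_smul, laurentEvalAt_single_eq_smul, one_smul, one_smul, one_smul,
      one_smul, laurentMonomialHom_ofAdd_eq_zpow_two _ he, laurentMonomialHom_ofAdd_eq_zpow_two _ he',
      laurentMonomialHom_ofAdd_eq_zpow_two _ he, laurentMonomialHom_ofAdd_eq_zpow_two _ he'] at key
    simp only [Matrix.cons_val_zero, Pi.neg_apply, zpow_one, _root_.zpow_neg_one] at key
    exact Units.eq_or_eq_inv_of_add_inv_eq _ _ key.symm
  · rintro (h | h)
    · exact hd.heckeEigencharacter_eq_of_div_eq_unitary_two β β' h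
    · rw [← hd.heckeEigencharacter_inv_unitary hσ β']
      refine hd.heckeEigencharacter_eq_of_div_eq_unitary_two β β'⁻¹ ?_
      rw [Pi.inv_apply, Pi.inv_apply, inv_div_inv, ← inv_div, h, inv_inv]

end Two

end UnramifiedLocalConjDatum

end Literature.NumberTheory.Automorphic.HermitianLattice

/-! ## §4 `U(3)`, `U(2)` at every inert unramified place -/

namespace Literature.NumberTheory.Automorphic.UnitaryGroup

open Literature.NumberTheory.Automorphic.HermitianLattice Literature.NumberTheory.Automorphic

variable {F E : Type} [Field F] [NumberField F] [Field E] [NumberField E] [Algebra F E] [Algebra.IsQuadraticExtension F E]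
  (c : E ≃ₐ[F] E) (hc1 : c ≠ 1) (v : HeightOneSpectrum (𝓞 F)) (w : PlacesOver E v) (hw : c • w.1 = w.1)
  (hv : Algebra.IsUnramifiedIn (𝓞 E) v.asIdeal)

/-- **`λ_{β'} = λ_β ⟺ β'₀/β'₂ ∈ {β₀/β₂, β₂/β₀}` for `U(3)(E_w/F_v)` at every inert unramified place.**
[cite: CartierCorvallis1979, §IV Cor. 4.2] [cite: Rogawski1990, §4.5 p. 50] -/
theorem unitaryHeckeEigencharacterAdic_eq_iff_three (β β' : Fin 3 → ℂˣ) :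
    unitaryHeckeEigencharacterAdic c hc1 v w hw hv β' = unitaryHeckeEigencharacterAdic c hc1 v w hw hv β ↔
      (β' 0 / β' 2 = β 0 / β 2 ∨ β' 0 / β' 2 = (β 0 / β 2)⁻¹) := by
  haveI := finite_residueField_adicCompletion E w.1
  haveI := isHeckeTriple_unitaryInt_adicCompletion c v w hw ((StdForm.antidiagonal 3).over (w.1.adicCompletion E))
  rw [unitaryHeckeEigencharacterAdic_eq c hc1 v w hw hv (unramifiedLocalConjDatum_localConjUniformizer c hc1 v w hw hv),
    unitaryHeckeEigencharacterAdic_eq c hc1 v w hw hv (unramifiedLocalConjDatum_localConjUniformizer c hc1 v w hw hv)]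
  exact (unramifiedLocalConjDatum_localConjUniformizer c hc1 v w hw hv).heckeEigencharacter_eq_iff_unitary_three
    (exists_galAdicCompletionMap_ne c hc1 v w hw) β β'

/-- **`λ_{β'} = λ_β ⟺ β'₀/β'₁ ∈ {β₀/β₁, β₁/β₀}` for `U(2)(E_w/F_v)` at every inert unramified place.**
[cite: CartierCorvallis1979, §IV Cor. 4.2] [cite: Rogawski1990, §4.5 p. 50] -/
theorem unitaryHeckeEigencharacterAdic_eq_iff_two (β β' : Fin 2 → ℂˣ) :
    unitaryHeckeEigencharacterAdic c hc1 v w hw hv β' = unitaryHeckeEigencharacterAdic c hc1 v w hw hv β ↔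
      (β' 0 / β' 1 = β 0 / β 1 ∨ β' 0 / β' 1 = (β 0 / β 1)⁻¹) := by
  haveI := finite_residueField_adicCompletion E w.1
  haveI := isHeckeTriple_unitaryInt_adicCompletion c v w hw ((StdForm.antidiagonal 2).over (w.1.adicCompletion E))
  rw [unitaryHeckeEigencharacterAdic_eq c hc1 v w hw hv (unramifiedLocalConjDatum_localConjUniformizer c hc1 v w hw hv),
    unitaryHeckeEigencharacterAdic_eq c hc1 v w hw hv (unramifiedLocalConjDatum_localConjUniformizer c hc1 v w hw hv)]
  exact (unramifiedLocalConjDatum_localConjUniformizer c hc1 v w hw hv).heckeEigencharacter_eq_iff_unitary_two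
    (exists_galAdicCompletionMap_ne c hc1 v w hw) β β'

end Literature.NumberTheory.Automorphic.UnitaryGroup
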